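import Summits.Parity.GeneralizedHardyLittlewood.Theorems.RomanoffHeathBrownSecondMomentTools

/-! # RomanoffHeathBrown — the pair-sieve reduction of the second moment:
`secondMomentReduction_proof : SecondMomentReduction` (item stmt-Parity-20275 of
`route-Parity-RomanoffHeathBrown`)

With `u = hbWeight c N`, `θ_N(m) = log m` on the odd primes `m ≤ N` (else `0`) and
`R(n) = ∑_{k ≤ N} u(k) θ_N(n − k)`:
`∑_{n ≤ 2N} R(n)² = ∑_{k,k'} u(k) u(k') T(k,k')`, `T(k,k') = ∑_n θ_N(n−k) θ_N(n−k')`; the diagonal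
`T(k,k) ≤ ∑_{p ≤ N} (log p)² ≤ log N · ϑ(N) ≤ log 4 · N log N` (Chebyshev) is paired with
`∑_k u(k)² ≤ (max u) U`, `max u ≤ N^{1/3} log N (ηX + 2)`; a shift `h = |k − k'| ≥ 1` costs
`T(k,k') ≤ (log N)² #{p ≤ N : p + h prime} ≤ C_pair N h/φ(h)` (the pair sieve
`Literature.NumberTheory.Sieve.primePairs_card_le`) and `h/φ(h) ≤ 2 ∑_{d ∣ h, d odd squarefree} g(d)`,
`g(d) = ∏_{p ∣ d} 1/(p−2)`; swapping the `d`-sum with the `(k,k')`-sum turns `d ∣ k − k'` into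
`k ≡ k' (mod d)` and produces the class energies `∑_d g(d) ∑_{r mod d} U_d(r)²`.
Sources: [Nathanson1996] (§7.6), [Romanoff1934], [MontgomeryVaughan2007] (Cor. 3.14). -/

noncomputable section

open Finset Filter
open scoped Topology

namespace Summit.Parity.GeneralizedHardyLittlewood.Theses.RomanoffHeathBrown

open Literature.NumberTheory.Sieve Literature.NumberTheory.Sieve.CubicPrimes
open Literature.NumberTheory.Sieve.CubicMinorant

/-- **The off-diagonal pair**: for `1 ≤ k < k' ≤ N` (shift `h = k' − k`) and a weight `θ` supported
on the primes `≤ N` with `θ ≤ log`,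
`∑_{n ≤ 2N} θ(n−k) θ(n−k') ≤ C_pair N · 2 ∑_{d ≤ N odd squarefree, k ≡ k' (d)} ∏_{p ∣ d} 1/(p−2)`,
given the pair-sieve bound `#{p ≤ N : p + h prime} ≤ C_pair (h/φ(h)) N/log² N` at this `N`.
[cite: Nathanson1996, §7.6 (proof of Romanoff's theorem)] -/
theorem pair_sum_offdiag_le {N : ℕ} (hN : 2 ≤ N) {θ : ℕ → ℝ} (hθ0 : ∀ m, 0 ≤ θ m)
    (hθ : ∀ m, θ m ≠ 0 → m.Prime ∧ m ≤ N ∧ θ m ≤ Real.log m) {Cp : ℝ} (hCp0 : 0 ≤ Cp)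
    (hCp : ∀ h : ℕ, 1 ≤ h → h ≤ N →
      (#{p ∈ Nat.primesLE N | (p + h).Prime} : ℝ) ≤
        Cp * (((h : ℝ) / Nat.totient h) * ((N : ℝ) / Real.log N ^ 2)))
    {k k' : ℕ} (hk : k ∈ Icc 1 N) (hk' : k' ∈ Icc 1 N) (hlt : k < k') :
    ∑ n ∈ Icc 1 (2 * N), θ (n - k) * θ (n - k') ≤
      Cp * N * (2 * ∑ d ∈ ((Icc 1 N).filter (fun d : ℕ => Squarefree d ∧ Odd d)).filter
        (fun d : ℕ => k ≡ k' [MOD d]), ∏ p ∈ d.primeFactors, (1 : ℝ) / ((p : ℝ) - 2)) := by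
  rw [mem_Icc] at hk hk'
  set h := k' - k with hh
  have h1 : 1 ≤ h := by omega
  have hhN : h ≤ N := by omega
  have hθz : θ 0 = 0 := theta_zero hθ
  have hlog : 0 < Real.log N := Real.log_pos (by exact_mod_cast (show 1 < N by omega))
  have hterm : ∀ n, θ (n - k) * θ (n - k') = (fun m => θ (m + h) * θ m) (n - k') := by
    intro n
    simp only
    by_cases hn : k' ≤ n
    · congr 2; omega
    · have e : n - k' = 0 := by omega
      rw [e, hθz, mul_zero, mul_zero]
  calc ∑ n ∈ Icc 1 (2 * N), θ (n - k) * θ (n - k')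
      = ∑ n ∈ Icc 1 (2 * N), (fun m => θ (m + h) * θ m) (n - k') :=
        Finset.sum_congr rfl fun n _ => hterm n
    _ ≤ ∑ m ∈ range (2 * N + 1), θ (m + h) * θ m :=
        sum_Icc_sub_le (g := fun m => θ (m + h) * θ m) (by simp [hθz])
          (fun m => mul_nonneg (hθ0 _) (hθ0 _)) N k'
    _ ≤ Real.log N ^ 2 * #{p ∈ Nat.primesLE N | (p + h).Prime} :=
        sum_theta_shift_mul_le hθ0 hθ h
    _ ≤ Real.log N ^ 2 * (Cp * (((h : ℝ) / Nat.totient h) * ((N : ℝ) / Real.log N ^ 2))) :=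
        mul_le_mul_of_nonneg_left (hCp h h1 hhN) (sq_nonneg _)
    _ = Cp * N * ((h : ℝ) / Nat.totient h) := by field_simp
    _ ≤ Cp * N * (2 * ∑ d ∈ ((Icc 1 N).filter (fun d : ℕ => Squarefree d ∧ Odd d)).filter
          (fun d : ℕ => d ∣ h), ∏ p ∈ d.primeFactors, (1 : ℝ) / ((p : ℝ) - 2)) :=
        mul_le_mul_of_nonneg_left (self_div_totient_le h1 hhN) (by positivity)
    _ = _ := by
        congr 2
        refine Finset.sum_congr (Finset.filter_congr fun d _ => ?_) fun _ _ => rfl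
        rw [hh]
        exact (Nat.modEq_iff_dvd' hlt.le).symm

/-- **Both pairs at once**: for `k, k' ∈ [1, N]`,
`∑_{n ≤ 2N} θ(n−k) θ(n−k') ≤ [k = k'] · log N · log 4 · N + C_pair N · 2 ∑_{d, k ≡ k' (d)} g(d)`.
[cite: Nathanson1996, §7.6 (proof of Romanoff's theorem)] -/
theorem pair_sum_le {N : ℕ} (hN : 2 ≤ N) {θ : ℕ → ℝ} (hθ0 : ∀ m, 0 ≤ θ m)
    (hθ : ∀ m, θ m ≠ 0 → m.Prime ∧ m ≤ N ∧ θ m ≤ Real.log m) {Cp : ℝ} (hCp0 : 0 ≤ Cp)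
    (hCp : ∀ h : ℕ, 1 ≤ h → h ≤ N →
      (#{p ∈ Nat.primesLE N | (p + h).Prime} : ℝ) ≤
        Cp * (((h : ℝ) / Nat.totient h) * ((N : ℝ) / Real.log N ^ 2)))
    {k k' : ℕ} (hk : k ∈ Icc 1 N) (hk' : k' ∈ Icc 1 N) :
    ∑ n ∈ Icc 1 (2 * N), θ (n - k) * θ (n - k') ≤
      (if k = k' then Real.log N * (Real.log 4 * N) else 0) +
        Cp * N * (2 * ∑ d ∈ ((Icc 1 N).filter (fun d : ℕ => Squarefree d ∧ Odd d)).filter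
          (fun d : ℕ => k ≡ k' [MOD d]), ∏ p ∈ d.primeFactors, (1 : ℝ) / ((p : ℝ) - 2)) := by
  have hE0 : 0 ≤ Cp * N * (2 * ∑ d ∈ ((Icc 1 N).filter (fun d : ℕ => Squarefree d ∧ Odd d)).filter
      (fun d : ℕ => k ≡ k' [MOD d]), ∏ p ∈ d.primeFactors, (1 : ℝ) / ((p : ℝ) - 2)) := by
    refine mul_nonneg (by positivity) (mul_nonneg (by norm_num) (Finset.sum_nonneg fun d hd => ?_))
    exact prod_primeFactors_inv_sub_two_nonneg (mem_filter.mp (mem_filter.mp hd).1).2.2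
  rcases lt_trichotomy k k' with hlt | heq | hgt
  · rw [if_neg hlt.ne, zero_add]
    exact pair_sum_offdiag_le hN hθ0 hθ hCp0 hCp hk hk' hlt
  · subst heq
    rw [if_pos rfl]
    refine le_trans ?_ (le_add_of_nonneg_right hE0)
    calc ∑ n ∈ Icc 1 (2 * N), θ (n - k) * θ (n - k)
        = ∑ n ∈ Icc 1 (2 * N), (fun m => θ m ^ 2) (n - k) :=
          Finset.sum_congr rfl fun n _ => by simp only [sq]
      _ ≤ ∑ m ∈ range (2 * N + 1), θ m ^ 2 :=
          sum_Icc_sub_le (g := fun m => θ m ^ 2) (by simp [theta_zero hθ])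
            (fun m => sq_nonneg _) N k
      _ ≤ _ := sum_theta_sq_le hθ0 hθ
  · rw [if_neg hgt.ne']
    have hsym : ∑ n ∈ Icc 1 (2 * N), θ (n - k) * θ (n - k') =
        ∑ n ∈ Icc 1 (2 * N), θ (n - k') * θ (n - k) :=
      Finset.sum_congr rfl fun n _ => mul_comm _ _
    have hfil : ((Icc 1 N).filter (fun d : ℕ => Squarefree d ∧ Odd d)).filter
        (fun d : ℕ => k ≡ k' [MOD d]) =
        ((Icc 1 N).filter (fun d : ℕ => Squarefree d ∧ Odd d)).filter
          (fun d : ℕ => k' ≡ k [MOD d]) :=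
      Finset.filter_congr fun d _ => ⟨Nat.ModEq.symm, Nat.ModEq.symm⟩
    rw [zero_add, hsym, hfil]
    exact pair_sum_offdiag_le hN hθ0 hθ hCp0 hCp hk' hk hgt

/-- **The reduction, for a general weight `θ`** supported on the primes `≤ N` with `θ ≤ log`:
there are `C, N₀` (depending on nothing but the pair-sieve constant) with
`∑_{n ≤ 2N} (∑_k u(k) θ(n−k))² ≤ C (N log N) (N^{1/3} log N (ηX+2)) U + C N ∑_d g(d) ∑_r U_d(r)²`
for `N ≥ N₀`, `u = hbWeight c N`. [cite: Nathanson1996, §7.6 (proof of Romanoff's theorem)] -/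
theorem secondMoment_le (c : ℝ) : ∃ C : ℝ, ∃ N₀ : ℕ, ∀ N : ℕ, N₀ ≤ N → ∀ θ : ℕ → ℝ,
    (∀ m, 0 ≤ θ m) → (∀ m, θ m ≠ 0 → m.Prime ∧ m ≤ N ∧ θ m ≤ Real.log m) →
    ∑ n ∈ Icc 1 (2 * N), (∑ k ∈ Icc 1 N, hbWeight c N k * θ (n - k)) ^ 2 ≤
      C * ((N : ℝ) * Real.log N) *
          ((N : ℝ) ^ ((1 : ℝ) / 3) * Real.log N * (hbEta c N * hbX N + 2)) *
          ∑ k ∈ Icc 1 N, hbWeight c N k +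
        C * (N : ℝ) * ∑ d ∈ (Icc 1 N).filter (fun d : ℕ => Squarefree d ∧ Odd d),
          (∏ p ∈ d.primeFactors, (1 : ℝ) / ((p : ℝ) - 2)) *
            ∑ r ∈ range d, (∑ k ∈ (Icc 1 N).filter (fun k : ℕ => k ≡ r [MOD d]),
              hbWeight c N k) ^ 2 := by
  obtain ⟨Cp, hCp⟩ := Literature.NumberTheory.Sieve.primePairs_card_le
  refine ⟨max (Real.log 4) (2 * max Cp 0), 7, fun N hN θ hθ0 hθ => ?_⟩
  have hN2 : 2 ≤ N := by omega
  have hN6 : 6 < N := by omega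
  have hCp0 : 0 ≤ max Cp 0 := le_max_right _ _
  have hCp' : ∀ h : ℕ, 1 ≤ h → h ≤ N →
      (#{p ∈ Nat.primesLE N | (p + h).Prime} : ℝ) ≤
        max Cp 0 * (((h : ℝ) / Nat.totient h) * ((N : ℝ) / Real.log N ^ 2)) := by
    intro h h1 hhN
    refine (hCp N h h1 hhN hN2).trans (mul_le_mul_of_nonneg_right (le_max_left _ _) ?_)
    have : (0 : ℝ) ≤ Nat.totient h := Nat.cast_nonneg _
    positivity
  set K := Icc 1 N with hK
  set D := (Icc 1 N).filter (fun d : ℕ => Squarefree d ∧ Odd d) with hD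
  set u : ℕ → ℝ := hbWeight c N with hu
  set g : ℕ → ℝ := fun d => ∏ p ∈ d.primeFactors, (1 : ℝ) / ((p : ℝ) - 2) with hg
  set A : ℝ := Real.log N * (Real.log 4 * N) with hA
  set B : ℝ := max Cp 0 * N with hB
  set M : ℝ := (N : ℝ) ^ ((1 : ℝ) / 3) * Real.log N * (hbEta c N * hbX N + 2) with hM
  have hu0 : ∀ k, 0 ≤ u k := fun k => hbWeight_nonneg c N k
  have huM : ∀ k ∈ K, u k ≤ M := fun k hk => hbWeight_le_max c hN6 hk
  have hg0 : ∀ d ∈ D, 0 ≤ g d := fun d hd =>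
    prod_primeFactors_inv_sub_two_nonneg (mem_filter.mp hd).2.2
  have hDpos : ∀ d ∈ D, 0 < d := fun d hd => (mem_Icc.mp (mem_filter.mp hd).1).1
  have hA0 : 0 ≤ A := by
    have : 0 ≤ Real.log 4 := Real.log_nonneg (by norm_num)
    have := Real.log_natCast_nonneg N
    positivity
  have hB0 : 0 ≤ B := by positivity
  have hM0 : 0 ≤ M := le_trans (hu0 1) (huM 1 (by rw [hK, mem_Icc]; omega))
  -- the pairwise bound
  have hT : ∀ k ∈ K, ∀ k' ∈ K, ∑ n ∈ Icc 1 (2 * N), θ (n - k) * θ (n - k') ≤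
      (if k = k' then A else 0) + B * (2 * ∑ d ∈ D.filter (fun d : ℕ => k ≡ k' [MOD d]), g d) :=
    fun k hk k' hk' => pair_sum_le hN2 hθ0 hθ hCp0 hCp' hk hk'
  -- expand the square and apply it
  have hstep : ∑ n ∈ Icc 1 (2 * N), (∑ k ∈ K, u k * θ (n - k)) ^ 2 ≤
      A * ∑ k ∈ K, u k * u k +
        2 * B * ∑ k ∈ K, ∑ k' ∈ K, u k * u k' * ∑ d ∈ D.filter (fun d : ℕ => k ≡ k' [MOD d]), g d := by
    rw [sum_sq_sum_eq]
    calc ∑ k ∈ K, ∑ k' ∈ K, ∑ n ∈ Icc 1 (2 * N), u k * θ (n - k) * (u k' * θ (n - k'))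
        = ∑ k ∈ K, ∑ k' ∈ K, u k * u k' * ∑ n ∈ Icc 1 (2 * N), θ (n - k) * θ (n - k') := by
          refine Finset.sum_congr rfl fun k _ => Finset.sum_congr rfl fun k' _ => ?_
          rw [Finset.mul_sum]
          exact Finset.sum_congr rfl fun n _ => by ring
      _ ≤ ∑ k ∈ K, ∑ k' ∈ K, u k * u k' *
            ((if k = k' then A else 0) + B * (2 * ∑ d ∈ D.filter (fun d : ℕ => k ≡ k' [MOD d]), g d)) :=
          Finset.sum_le_sum fun k hk => Finset.sum_le_sum fun k' hk' =>
            mul_le_mul_of_nonneg_left (hT k hk k' hk') (mul_nonneg (hu0 k) (hu0 k'))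
      _ = ∑ k ∈ K, ∑ k' ∈ K, (if k = k' then u k * u k' * A else 0) +
            ∑ k ∈ K, ∑ k' ∈ K,
              2 * B * (u k * u k' * ∑ d ∈ D.filter (fun d : ℕ => k ≡ k' [MOD d]), g d) := by
          rw [← Finset.sum_add_distrib]
          refine Finset.sum_congr rfl fun k _ => ?_
          rw [← Finset.sum_add_distrib]
          refine Finset.sum_congr rfl fun k' _ => ?_
          split_ifs <;> ring
      _ = A * ∑ k ∈ K, u k * u k +
            2 * B * ∑ k ∈ K, ∑ k' ∈ K,
              u k * u k' * ∑ d ∈ D.filter (fun d : ℕ => k ≡ k' [MOD d]), g d := by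
          congr 1
          · rw [Finset.mul_sum]
            refine Finset.sum_congr rfl fun k hk => ?_
            rw [Finset.sum_ite_eq, if_pos hk]; ring
          · rw [Finset.mul_sum]
            exact Finset.sum_congr rfl fun k _ => by rw [Finset.mul_sum]
  -- the diagonal mass `∑ u² ≤ M U`
  have hdiag : ∑ k ∈ K, u k * u k ≤ M * ∑ k ∈ K, u k := by
    rw [Finset.mul_sum]
    exact Finset.sum_le_sum fun k hk => mul_le_mul_of_nonneg_right (huM k hk) (hu0 k)
  -- the class energies
  have henergy : ∑ k ∈ K, ∑ k' ∈ K, u k * u k' * ∑ d ∈ D.filter (fun d : ℕ => k ≡ k' [MOD d]), g d =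
      ∑ d ∈ D, g d * ∑ r ∈ range d, (∑ k ∈ K.filter (fun k : ℕ => k ≡ r [MOD d]), u k) ^ 2 := by
    rw [sum_sum_mul_sum_filter_modEq]
    exact Finset.sum_congr rfl fun d hd => by rw [sum_range_classSum_sq (hDpos d hd)]
  have hU0 : 0 ≤ ∑ k ∈ K, u k := Finset.sum_nonneg fun k _ => hu0 k
  have hE0 : 0 ≤ ∑ d ∈ D, g d * ∑ r ∈ range d,
      (∑ k ∈ K.filter (fun k : ℕ => k ≡ r [MOD d]), u k) ^ 2 :=
    Finset.sum_nonneg fun d hd => mul_nonneg (hg0 d hd) (Finset.sum_nonneg fun _ _ => sq_nonneg _)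
  have hlogN : 0 ≤ Real.log N := Real.log_natCast_nonneg N
  show ∑ n ∈ Icc 1 (2 * N), (∑ k ∈ K, u k * θ (n - k)) ^ 2 ≤
    max (Real.log 4) (2 * max Cp 0) * ((N : ℝ) * Real.log N) * M * ∑ k ∈ K, u k +
      max (Real.log 4) (2 * max Cp 0) * (N : ℝ) * ∑ d ∈ D, g d * ∑ r ∈ range d,
        (∑ k ∈ K.filter (fun k : ℕ => k ≡ r [MOD d]), u k) ^ 2
  calc ∑ n ∈ Icc 1 (2 * N), (∑ k ∈ K, u k * θ (n - k)) ^ 2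
      ≤ A * ∑ k ∈ K, u k * u k +
          2 * B * ∑ k ∈ K, ∑ k' ∈ K,
            u k * u k' * ∑ d ∈ D.filter (fun d : ℕ => k ≡ k' [MOD d]), g d := hstep
    _ ≤ A * (M * ∑ k ∈ K, u k) +
          2 * B * ∑ d ∈ D, g d * ∑ r ∈ range d,
            (∑ k ∈ K.filter (fun k : ℕ => k ≡ r [MOD d]), u k) ^ 2 := by
        rw [henergy]
        exact add_le_add (mul_le_mul_of_nonneg_left hdiag hA0) le_rfl
    _ = Real.log 4 * ((N : ℝ) * Real.log N) * M * ∑ k ∈ K, u k +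
          2 * max Cp 0 * (N : ℝ) * ∑ d ∈ D, g d * ∑ r ∈ range d,
            (∑ k ∈ K.filter (fun k : ℕ => k ≡ r [MOD d]), u k) ^ 2 := by
        rw [hA, hB]; ring
    _ ≤ _ := by
        apply add_le_add
        · have h4 : Real.log 4 ≤ max (Real.log 4) (2 * max Cp 0) := le_max_left _ _
          have hX : 0 ≤ ((N : ℝ) * Real.log N) * M * ∑ k ∈ K, u k :=
            mul_nonneg (mul_nonneg (mul_nonneg (Nat.cast_nonneg N) hlogN) hM0) hU0
          calc Real.log 4 * ((N : ℝ) * Real.log N) * M * ∑ k ∈ K, u k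
              = Real.log 4 * (((N : ℝ) * Real.log N) * M * ∑ k ∈ K, u k) := by ring
            _ ≤ max (Real.log 4) (2 * max Cp 0) * (((N : ℝ) * Real.log N) * M * ∑ k ∈ K, u k) :=
                mul_le_mul_of_nonneg_right h4 hX
            _ = _ := by ring
        · have h4 : 2 * max Cp 0 ≤ max (Real.log 4) (2 * max Cp 0) := le_max_right _ _
          have hX : 0 ≤ (N : ℝ) * ∑ d ∈ D, g d * ∑ r ∈ range d,
              (∑ k ∈ K.filter (fun k : ℕ => k ≡ r [MOD d]), u k) ^ 2 :=
            mul_nonneg (Nat.cast_nonneg N) hE0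
          calc 2 * max Cp 0 * (N : ℝ) * ∑ d ∈ D, g d * ∑ r ∈ range d,
                (∑ k ∈ K.filter (fun k : ℕ => k ≡ r [MOD d]), u k) ^ 2
              = 2 * max Cp 0 * ((N : ℝ) * ∑ d ∈ D, g d * ∑ r ∈ range d,
                  (∑ k ∈ K.filter (fun k : ℕ => k ≡ r [MOD d]), u k) ^ 2) := by ring
            _ ≤ max (Real.log 4) (2 * max Cp 0) * ((N : ℝ) * ∑ d ∈ D, g d * ∑ r ∈ range d,
                  (∑ k ∈ K.filter (fun k : ℕ => k ≡ r [MOD d]), u k) ^ 2) :=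
                mul_le_mul_of_nonneg_right h4 hX
            _ = _ := by ring

/-- **SecondMomentReduction PROVED** (item stmt-Parity-20275): the case
`θ = θ_N = log` on the odd primes `≤ N` of `secondMoment_le`. [this line] -/
theorem secondMomentReduction_proof : SecondMomentReduction := by
  unfold SecondMomentReduction
  intro c _hc
  obtain ⟨C, N₀, h⟩ := secondMoment_le c
  refine ⟨C, N₀, fun N hN => ?_⟩
  have hθ0 : ∀ m : ℕ, 0 ≤ (if m.Prime ∧ Odd m ∧ m ≤ N then Real.log (m : ℝ) else 0) := by
    intro m
    split_ifs
    · exact Real.log_natCast_nonneg m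
    · exact le_rfl
  have hθ : ∀ m : ℕ, (if m.Prime ∧ Odd m ∧ m ≤ N then Real.log (m : ℝ) else 0) ≠ 0 →
      m.Prime ∧ m ≤ N ∧ (if m.Prime ∧ Odd m ∧ m ≤ N then Real.log (m : ℝ) else 0) ≤ Real.log m := by
    intro m hm
    by_cases hc : m.Prime ∧ Odd m ∧ m ≤ N
    · rw [if_pos hc]; exact ⟨hc.1, hc.2.2, le_rfl⟩
    · rw [if_neg hc] at hm; exact absurd rfl hm
  exact h N hN (fun m => if m.Prime ∧ Odd m ∧ m ≤ N then Real.log (m : ℝ) else 0) hθ0 hθ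

end Summit.Parity.GeneralizedHardyLittlewood.Theses.RomanoffHeathBrown

end
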